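import Literature.Analysis.PDE.LinExistTools
import HarnessLib

/-!
# Passage to the limit with a convergent sequence of sources (topic `Analysis/PDE`)

A variant of `hasDerivWithinAt_words_of_limit` (`LinExistTools.lean`) for the quasilinear Picard
scheme (hypothesis `hQL` of `Literature.Geometry.Riemannian.ricciFlow_shortTime_existence_of_quasilinear`):
the sources `Θ_N` of the approximating equations `∂ₜ f_N = L f_N + Θ_N` vary with `N` and converge,
with all frame-word derivatives uniformly on the slab, to a limit `Θ_lim` that is only known to
have smooth slices. Then every word derivative of the limit `F` is differentiable in time within
`[0, T]` with derivative the word derivative of `L F + Θ_lim`.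

* `hasDerivWithinAt_words_of_limit'`.

Everything is proved; no named fact and no `sorry` is introduced.

## References

* L. C. Evans, *Partial Differential Equations*, 2nd ed., AMS 2010, §7.1.2, Thm. 3. [Evans2010]
-/

noncomputable section

open Set Function Filter Topology Metric MeasureTheory InnerProductSpace
open scoped ContDiff Topology ENNReal RealInnerProductSpace

namespace Literature.Analysis.PDE

open Literature.Analysis.FunctionSpaces Literature.Analysis.FluidPDE Literature.Analysis.Calculus

variable {E' : Type*} [NormedAddCommGroup E'] [InnerProductSpace ℝ E'] [FiniteDimensional ℝ E']
variable {F' : Type*} [NormedAddCommGroup F'] [InnerProductSpace ℝ F'] [FiniteDimensional ℝ F']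

/-- **Passage to the limit in the equation with convergent sources, word by word.** Let the
slab-smooth `f N` satisfy, near every point of `U`, `∂ₜ f_N = L_t f_N + Θ_N` with slab-smooth
coefficient fields constant outside a ball and slab-smooth sources `Θ_N`, and let the frame words
of `f N - F` and of `Θ_N - Θ_lim` tend to zero uniformly on the slab (`F`, `Θ_lim` with smooth
slices). Then every word derivative of `F` is differentiable in time within `[0, T]` at the points
of `U`, with derivative the word derivative of `L_t F + Θ_lim`. [cite: Evans2010, §7.1.2, Thm. 3] -/
theorem hasDerivWithinAt_words_of_limit' {T : ℝ} (hT : 0 < T) {S : ℝ → E' → (E' →L[ℝ] E')}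
    {𝔟 : ℝ → E' → ((E' →L[ℝ] F') →L[ℝ] F')} {𝔠 : ℝ → E' → (F' →L[ℝ] F')}
    (hS : IsSmoothSpaceTimeOn (Icc 0 T) S) (h𝔟 : IsSmoothSpaceTimeOn (Icc 0 T) 𝔟) (h𝔠 : IsSmoothSpaceTimeOn (Icc 0 T) 𝔠)
    {Rc : ℝ} (hSc : ∀ s y, Rc ≤ ‖y‖ → S s y = 1) (h𝔟c : ∀ s y, Rc ≤ ‖y‖ → 𝔟 s y = 0) (h𝔠c : ∀ s y, Rc ≤ ‖y‖ → 𝔠 s y = 0)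
    {Θ : ℕ → ℝ → E' → F'} (hΘ : ∀ N, IsSmoothSpaceTimeOn (Icc 0 T) (Θ N)) {Θl : ℝ → E' → F'} (hΘl : ∀ t ∈ Icc 0 T, ContDiff ℝ ∞ (Θl t))
    {f : ℕ → ℝ → E' → F'} (hf : ∀ N, IsSmoothSpaceTimeOn (Icc 0 T) (f N)) {U : Set E'}
    (heq : ∀ N, ∀ s ∈ Icc 0 T, ∀ x ∈ U, timeDerivWithin (Icc 0 T) (f N) s =ᶠ[𝓝 x]
      fun y ↦ frameOp (S s y) (𝔟 s y) (𝔠 s y) (f N s) y + Θ N s y)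
    {F : ℝ → E' → F'} (hFs : ∀ t ∈ Icc 0 T, ContDiff ℝ ∞ (F t))
    (hFu : ∀ β : List E', TendstoUniformlyOn (fun N (q : ℝ × E') ↦ iterDirDeriv β (f N q.1) q.2)
      (fun q ↦ iterDirDeriv β (F q.1) q.2) atTop (Icc 0 T ×ˢ univ))
    (hsmall : ∀ (m : ℕ) (ε : ℝ), 0 < ε → ∃ N₀ : ℕ, ∀ N ≥ N₀, ∀ w : List (Fin (Module.finrank ℝ E')), w.length ≤ m →
      ∀ t ∈ Icc 0 T, ∀ y, ‖iterDirDeriv (w.map (stdOrthonormalBasis ℝ E')) (f N t) y -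
        iterDirDeriv (w.map (stdOrthonormalBasis ℝ E')) (F t) y‖ ≤ ε)
    (hΘsmall : ∀ (m : ℕ) (ε : ℝ), 0 < ε → ∃ N₀ : ℕ, ∀ N ≥ N₀, ∀ w : List (Fin (Module.finrank ℝ E')), w.length ≤ m →
      ∀ t ∈ Icc 0 T, ∀ y, ‖iterDirDeriv (w.map (stdOrthonormalBasis ℝ E')) (Θ N t) y -
        iterDirDeriv (w.map (stdOrthonormalBasis ℝ E')) (Θl t) y‖ ≤ ε)
    (β : List E') {t : ℝ} (ht : t ∈ Icc 0 T) {x : E'} (hx : x ∈ U) :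
    HasDerivWithinAt (fun s ↦ iterDirDeriv β (F s) x)
      (iterDirDeriv β (fun y ↦ frameOp (S t y) (𝔟 t y) (𝔠 t y) (F t) y + Θl t y) x) (Icc 0 T) t := by
  set n : ℕ := Module.finrank ℝ E' with hn
  set m : ℕ := β.length with hm
  have hU := uniqueDiffOn_Icc hT
  have hfs : ∀ N, ∀ s ∈ Icc 0 T, ContDiff ℝ ∞ (f N s) := fun N s hs ↦ (hf N).contDiff_slice hs
  have hΘs : ∀ N, ∀ s ∈ Icc 0 T, ContDiff ℝ ∞ (Θ N s) := fun N s hs ↦ (hΘ N).contDiff_slice hs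
  -- the right-hand sides
  obtain ⟨G, hG⟩ : ∃ G : ℕ → ℝ → E' → F', G = fun N s y ↦ frameOp (S s y) (𝔟 s y) (𝔠 s y) (f N s) y + Θ N s y := ⟨_, rfl⟩
  have hGap : ∀ N s, G N s = fun y ↦ frameOp (S s y) (𝔟 s y) (𝔠 s y) (f N s) y + Θ N s y := fun N s ↦ by rw [hG]
  have hGs : ∀ N, IsSmoothSpaceTimeOn (Icc 0 T) (G N) := fun N ↦ by
    rw [hG]; exact (isSmoothSpaceTimeOn_frameOp hT hS h𝔟 h𝔠 (hf N)).add (hΘ N)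
  -- (hf): derivatives of the word derivatives of `f N` within `[0, T]`
  have hderiv : ∀ N, ∀ s ∈ Icc 0 T, HasDerivWithinAt (fun s ↦ iterDirDeriv β (f N s) x) (iterDirDeriv β (G N s) x) (Icc 0 T) s := by
    intro N s hs
    have hW := isSmoothSpaceTimeOn_iterDirDeriv_Icc hT (hf N) β
    have h1 := hW.hasDerivWithinAt_timeDerivWithin hU hs x
    have h2 : timeDerivWithin (Icc 0 T) (fun s ↦ iterDirDeriv β (f N s)) s x = iterDirDeriv β (G N s) x := by
      rw [timeDerivWithin_iterDirDeriv hT (hf N) β hs x, hGap]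
      exact (eventuallyEq_iterDirDeriv (heq N s hs x hx) β).eq_of_nhds
    rw [h2] at h1
    exact h1
  -- (hf'c): continuity of the derivatives on `[0, T]`
  have hcont : ∀ N, ContinuousOn (fun s ↦ iterDirDeriv β (G N s) x) (Icc 0 T) := by
    intro N
    have hW := (isSmoothSpaceTimeOn_iterDirDeriv_Icc hT (hGs N) β).continuousOn
    exact hW.comp (continuousOn_id.prodMk continuousOn_const) fun s hs ↦ mk_mem_prod hs (mem_univ x)
  -- (hfg): pointwise convergence
  have hptw : ∀ s ∈ Icc 0 T, Tendsto (fun N ↦ iterDirDeriv β (f N s) x) atTop (𝓝 (iterDirDeriv β (F s) x)) := fun s hs ↦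
    (hFu β).tendsto_at (mk_mem_prod hs (mem_univ x))
  -- (hf'g'): uniform convergence of the derivatives on `[0, T]`
  obtain ⟨Mc, hMc0, hMc⟩ : ∃ Mc : ℝ, 0 ≤ Mc ∧ (∀ s ∈ Icc 0 T, ∀ j ≤ m, ∀ y, ‖iteratedFDeriv ℝ j (S s) y‖ ≤ Mc) ∧
      (∀ s ∈ Icc 0 T, ∀ j ≤ m, ∀ y, ‖iteratedFDeriv ℝ j (𝔟 s) y‖ ≤ Mc) ∧ (∀ s ∈ Icc 0 T, ∀ j ≤ m, ∀ y, ‖iteratedFDeriv ℝ j (𝔠 s) y‖ ≤ Mc) := by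
    obtain ⟨M₁, h₁0, h₁⟩ := exists_forall_iteratedFDeriv_slab_le hT hS hSc m
    obtain ⟨M₂, h₂0, h₂⟩ := exists_forall_iteratedFDeriv_slab_le hT h𝔟 h𝔟c m
    obtain ⟨M₃, h₃0, h₃⟩ := exists_forall_iteratedFDeriv_slab_le hT h𝔠 h𝔠c m
    refine ⟨M₁ + M₂ + M₃, by positivity, fun s hs j hj y ↦ (h₁ s hs j hj y).trans (by linarith),
      fun s hs j hj y ↦ (h₂ s hs j hj y).trans (by linarith), fun s hs j hj y ↦ (h₃ s hs j hj y).trans (by linarith)⟩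
  obtain ⟨hMS, hMB, hMC⟩ := hMc
  set Pb : ℝ := ∏ i, ‖β.get i‖ with hPb
  have hPb0 : 0 ≤ Pb := Finset.prod_nonneg fun i _ ↦ norm_nonneg _
  set Cfo : ℝ := ((n : ℝ) ^ 2 * 2 ^ m + n + 1) * (2 ^ m * (2 ^ m * Mc)) * ((n : ℝ) + 1) ^ m with hCfo
  have hCfo0 : 0 ≤ Cfo := by positivity
  have hunif : TendstoUniformlyOn (fun N s ↦ iterDirDeriv β (G N s) x)
      (fun s ↦ iterDirDeriv β (fun y ↦ frameOp (S s y) (𝔟 s y) (𝔠 s y) (F s) y + Θl s y) x) atTop (Icc 0 T) := by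
    rw [Metric.tendstoUniformlyOn_iff]
    intro ε hε
    -- smallness thresholds
    obtain ⟨N₁, hN₁⟩ := hsmall (m + 2) (ε / (4 * (Cfo * Pb + 1))) (by positivity)
    obtain ⟨N₂, hN₂⟩ := hΘsmall m (ε / (4 * ((n : ℝ) ^ m * Pb + 1))) (by positivity)
    filter_upwards [Filter.eventually_ge_atTop (max N₁ N₂)] with N hN s hs
    have hN1 : N₁ ≤ N := (le_max_left _ _).trans hN
    have hN2 : N₂ ≤ N := (le_max_right _ _).trans hN
    rw [dist_eq_norm]
    -- the difference of the right-hand sides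
    have hu : ContDiff ℝ ∞ fun y ↦ F s y - f N s y := (hFs s hs).sub (hfs N s hs)
    have hlin : (fun y ↦ (frameOp (S s y) (𝔟 s y) (𝔠 s y) (F s) y + Θl s y) - G N s y) =
        fun y ↦ frameOp (S s y) (𝔟 s y) (𝔠 s y) (fun z ↦ F s z - f N s z) y + (Θl s y - Θ N s y) := by
      funext y
      simp only [hGap, frameOp_sub_fun _ _ _ (hFs s hs) (hfs N s hs)]
      abel
    have hSs := hS.contDiff_slice hs
    have h𝔟s := h𝔟.contDiff_slice hs
    have h𝔠s := h𝔠.contDiff_slice hs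
    have hFO : ContDiff ℝ ∞ fun y ↦ frameOp (S s y) (𝔟 s y) (𝔠 s y) (fun z ↦ F s z - f N s z) y :=
      contDiff_frameOp_slice hSs h𝔟s h𝔠s hu
    have hA : ContDiff ℝ ∞ fun y ↦ frameOp (S s y) (𝔟 s y) (𝔠 s y) (F s) y + Θl s y :=
      (contDiff_frameOp_slice hSs h𝔟s h𝔠s (hFs s hs)).add (hΘl s hs)
    have hΘd : ContDiff ℝ ∞ fun y ↦ Θl s y - Θ N s y := (hΘl s hs).sub (hΘs N s hs)
    rw [← iterDirDeriv_sub_apply hA ((hGs N).contDiff_slice hs), hlin,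
      show (fun y ↦ frameOp (S s y) (𝔟 s y) (𝔠 s y) (fun z ↦ F s z - f N s z) y + (Θl s y - Θ N s y)) =
        (fun y ↦ frameOp (S s y) (𝔟 s y) (𝔠 s y) (fun z ↦ F s z - f N s z) y) + fun y ↦ Θl s y - Θ N s y from rfl,
      iterDirDeriv_add hFO hΘd, Pi.add_apply]
    refine (norm_add_le _ _).trans_lt ?_
    -- the frame-operator term
    have hδ0 : 0 ≤ ε / (4 * (Cfo * Pb + 1)) := by positivity
    have hwords : ∀ w : List (Fin n), w.length ≤ m + 2 → ∀ y,
        ‖iterDirDeriv (w.map (stdOrthonormalBasis ℝ E')) (fun z ↦ F s z - f N s z) y‖ ≤ ε / (4 * (Cfo * Pb + 1)) := by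
      intro w hw y
      rw [iterDirDeriv_sub_apply (hFs s hs) (hfs N s hs), norm_sub_rev]
      exact hN₁ N hN1 w hw s hs y
    have hT1 := norm_iterDirDeriv_frameOp_le hSs h𝔟s h𝔠s hMc0 (hMS s hs) (hMB s hs) (hMC s hs) hu hδ0 hwords β hm.symm x
    have hT1' : ‖iterDirDeriv β (fun y ↦ frameOp (S s y) (𝔟 s y) (𝔠 s y) (fun z ↦ F s z - f N s z) y) x‖ ≤ ε / 4 := by
      refine hT1.trans ?_
      have hX : Cfo * Pb * (ε / (4 * (Cfo * Pb + 1))) ≤ ε / 4 := by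
        rw [div_eq_mul_inv, div_eq_mul_inv]
        have h4 : Cfo * Pb * (4 * (Cfo * Pb + 1))⁻¹ ≤ 4⁻¹ := by
          rw [mul_inv, ← mul_assoc]
          calc Cfo * Pb * 4⁻¹ * (Cfo * Pb + 1)⁻¹ ≤ (Cfo * Pb + 1) * 4⁻¹ * (Cfo * Pb + 1)⁻¹ := by gcongr; linarith
            _ = 4⁻¹ := by field_simp
        calc Cfo * Pb * (ε * (4 * (Cfo * Pb + 1))⁻¹) = ε * (Cfo * Pb * (4 * (Cfo * Pb + 1))⁻¹) := by ring
          _ ≤ ε * 4⁻¹ := mul_le_mul_of_nonneg_left h4 hε.le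
      calc _ = Cfo * Pb * (ε / (4 * (Cfo * Pb + 1))) := by rw [hCfo]; ring
        _ ≤ ε / 4 := hX
    -- the source term
    have hρ0 : 0 ≤ ε / (4 * ((n : ℝ) ^ m * Pb + 1)) := by positivity
    have hT2 := norm_iterDirDeriv_le_of_frame_words hΘd β x hρ0 fun w hw ↦ by
      rw [iterDirDeriv_sub_apply (hΘl s hs) (hΘs N s hs), norm_sub_rev]
      exact hN₂ N hN2 w (by omega) s hs x
    have hT2' : ‖iterDirDeriv β (fun y ↦ Θl s y - Θ N s y) x‖ ≤ ε / 4 := by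
      refine hT2.trans ?_
      have hpow : (Module.finrank ℝ E' : ℝ) ^ β.length = (n : ℝ) ^ m := by rw [hm]
      have hprod : ∏ i, ‖β.get i‖ = Pb := rfl
      rw [hpow, hprod]
      have h4 : (n : ℝ) ^ m * Pb * (4 * ((n : ℝ) ^ m * Pb + 1))⁻¹ ≤ 4⁻¹ := by
        rw [mul_inv, ← mul_assoc]
        calc (n : ℝ) ^ m * Pb * 4⁻¹ * ((n : ℝ) ^ m * Pb + 1)⁻¹ ≤ ((n : ℝ) ^ m * Pb + 1) * 4⁻¹ * ((n : ℝ) ^ m * Pb + 1)⁻¹ := by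
              gcongr; linarith
          _ = 4⁻¹ := by field_simp
      calc (n : ℝ) ^ m * (ε / (4 * ((n : ℝ) ^ m * Pb + 1))) * Pb = ε * ((n : ℝ) ^ m * Pb * (4 * ((n : ℝ) ^ m * Pb + 1))⁻¹) := by ring
        _ ≤ ε * 4⁻¹ := mul_le_mul_of_nonneg_left h4 hε.le
        _ = ε / 4 := by ring
    linarith
  exact hasDerivWithinAt_of_tendstoUniformlyOn_Icc hderiv hcont hptw hunif ht


end Literature.Analysis.PDE
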